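import Summits.CriticalPhenomena.Ising3DConformalLimit.Theorems.EnergyNotSigmaSquaredGapForcesFarMergingScreeningAnnularGlue
import Summits.CriticalPhenomena.Ising3DConformalLimit.Theorems.EnergyNotSigmaSquaredGapForcesFarMergingRootOpacity

/-! # Far-source insensitivity from strand mixing and far-end oscillation of the screening ratio
(line `screening-form-lemma-a1` of crux `GapForcesFarMerging`, item stmt-CriticalPhenomena-4468;
helper file of the open stub `stub_farSource : FarSourceInsensitivity`, currency of `Theorems/…ScreeningDefsAnnular.lean`)

`FarSourceInsensitivity` moves BOTH far ends of the configuration — the strand end `up M` and the probe end `dn M`,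
`M = 2^{K+3}` — down to `M' = 2^{k+A+3} ≤ M` (aspect `2^A` free) at the additive cost `μ/2` in the UNTILTED mean
annular screening `annScreen n k 0 (up M) a (dn M) = E^{0,up M;∅}_{Λ_n}[𝟙[dn M ∉ C]·S⁽ⁿ⁾_{a,dn M}(C_{2^{k+1}}(0) ∖ Λ_{2^k})]`
of the deep-source probe `a = 2^{k-j}u`. Two things move and nothing else:

* (M) the LAW of the explored cluster `C_{2^{k+1}}(0)` (hence of the obstacle `T_ω = C_{2^{k+1}}(0) ∖ Λ_{2^k}`) under the
  one-strand box law `P^{0,up M;∅}_{Λ_n}` versus `P^{0,up M';∅}_{Λ_n}`: STRAND MIXING = insensitivity in total variation,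
  uniformly in the octave `k`, of the law of the cluster explored inside `Λ_{2^{k+1}}` to the position of the far source
  beyond aspect `2^A` — the uniform-in-scale form of Panis' sourced incipient infinite cluster (Panis 2025 Thm 3.1, whose
  proof is the qualitative mixing Thm 2.4; the tree's named fact `currentIIC_limit_exists` is the NON-uniform limit
  `M → ∞` at fixed `k`);
* (O) the deterministic functional `T ↦ S⁽ⁿ⁾_{a,dn M}(T)` for a FIXED obstacle `T` in the annulus as the far probe end moves
  `dn M → dn M'`: FAR-END OSCILLATION of the screening ratio, `S_{a,dn M'}(T) ≤ S_{a,dn M}(T) + ε` for all near points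
  `a ∈ Λ_{2^{k+c}} ∖ T` and both far ends beyond aspect `2^A` (the double-ratio regularity
  `⟨σ_aσ_{z'}⟩_{Λ_n∖T}⟨σ_aσ_z⟩_{Λ_n} ≈ ⟨σ_aσ_z⟩_{Λ_n∖T}⟨σ_aσ_{z'}⟩_{Λ_n}` of Aizenman–Duminil-Copin 2021 Thm 6.4 / (6.16),
  known with a rate for `d = 4`, open in `d = 3` in this uniform form);
plus the vanishing one-point density `P^{0,up M;∅}_{Λ_n}[dn M ∈ C(0)] = ⟨σ_{up}σ_{dn}⟩⟨σ₀σ_{dn}⟩/⟨σ₀σ_{up}⟩ → G(2Me₂) ≤ C/(2M)`,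
which is PROVED (tree theorem `dnDensity_eventually_lt`: switching, reflection invariance, infrared bound) and strips the
indicator `𝟙[dn M ∉ C]`. The transfer (`farSrc_step`): pointwise
`annWeight(a, dn M') ≤ f(C_{2^{k+1}}(0)) + ε` with `f(C) = clip_{[0,1]} S_{a,dn M}(C ∖ Λ_{2^k})` (by (O) at the random obstacle;
the junk branch `a ∈ T_ω` contributes `S = ⟨σ_{dn}⟩^∅/⟨σσ⟩ = 0`), then (M) for `f`, then `f(C) ≤ annWeight(a, dn M) + 𝟙[dn M ∈ C]`,
integrated against the two probability measures: `annScreen(M') ≤ annScreen(M) + 3ε`. This is the registered reduction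
`farSource_of_strandMixing_probeOscillation : (M) → (O) → FarSourceInsensitivity`; its multiplicative variant
`farSource_of_strandMixing_probeDoubleRatio` states (O) as the double-ratio bound on `boxTwoPoint`. Neither (M) nor (O)
is proved here. References: R. Panis, PTRF 194 (2025) Thm 2.4, Thm 3.1; Aizenman–Duminil-Copin 2021 (arXiv:1912.07973)
§6.2, Thm 6.4, (6.16), eq. (3.10); Friedli–Velenik 2017 eq. (3.33), Exercise 3.12. -/

noncomputable section

namespace Summit.CriticalPhenomena.Ising3DConformalLimit.EnergyNotSigmaSquaredGapForcesFarMerging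

open scoped symmDiff ENNReal
open MeasureTheory Filter Finset
open Literature.Probability.LatticeModels Literature.Probability.Percolation
open Summit.CriticalPhenomena.Ising3DConformalLimit.Theorems.GapForcesFarMerging.Negative
  (e₁ e₂ cc2 xR up dn FarMergingShape SinglePinchLawShape)
open Summit.CriticalPhenomena.Ising3DConformalLimit.GapForcesFarMergingScreening

/-! ### The junk branch of the screening ratio vanishes; `S ∈ [0,1]` for every near point of the box -/

/-- **Junk branch of the free two-point function**: with the first point OFF the free region `R` its spin is frozen to
`+1`, so `⟨σ_aσ_b⟩^∅_R = ⟨σ_b⟩^∅_R = 0` at zero field (global spin flip). [cite: FriedliVelenik2017, §3.7.1, eq. (3.33)] -/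
theorem farSrc_isingTwoPoint_eq_zero {R : Finset (Site 3)} (β : ℝ) {a b : Site 3} (ha : a ∉ R) (hb : b ∈ R) :
    isingTwoPoint (zdGraph 3) R β 0 .free a b = 0 := by
  -- adapted from `isingTwoPoint_free_nonneg_of_notMem` (…ScreeningAnnularGlue.lean)
  have key : isingTwoPoint (zdGraph 3) R β 0 .free a b = isingCorr (zdGraph 3) R β 0 .free {b} := by
    unfold isingTwoPoint isingCorr isingExpect
    rw [integral_isingMeasure (zdGraph 3) R β 0 .free (measurable_spinPair a b),
      integral_isingMeasure (zdGraph 3) R β 0 .free (measurable_spinProduct {b})]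
    congr 1
    refine Finset.sum_congr rfl fun τ _ => ?_
    congr 1
    simp [spinPair, spinProduct, spinAt, glue_apply_of_notMem R τ _ ha, BoundaryCondition.outside]
  rw [key]
  exact isingCorr_free_singleton_zero_field _ _ _ hb

/-- **Junk branch of the depleted box two-point function**: `⟨σ_aσ_b⟩^∅_{Λ_n∖T} = 0` for `a ∉ Λ_n ∖ T`, `b ∈ Λ_n ∖ T`. [cite: FriedliVelenik2017, §3.7.1, eq. (3.33)] -/
theorem farSrc_boxTwoPoint_eq_zero {n : ℕ} {T : Finset (Site 3)} {a b : Site 3} (ha : a ∉ box 3 n \ T)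
    (hb : b ∈ box 3 n \ T) : boxTwoPoint n T a b = 0 :=
  farSrc_isingTwoPoint_eq_zero (criticalBeta 3) ha hb

/-- `S⁽ⁿ⁾_{ab}(T) = 0` on the junk branch `a ∈ T` (`b ∈ Λ_n ∖ T`). [cite: FriedliVelenik2017, §3.7.1, eq. (3.33)] -/
theorem farSrc_screening_eq_zero {n : ℕ} {T : Finset (Site 3)} {a b : Site 3} (ha : a ∈ T)
    (hb : b ∈ box 3 n \ T) : screening n T a b = 0 := by
  unfold screening
  rw [farSrc_boxTwoPoint_eq_zero (fun h => (Finset.mem_sdiff.1 h).2 ha) hb, zero_div]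

/-- `0 ≤ S⁽ⁿ⁾_{ab}(T) ≤ 1` for EVERY `a ∈ Λ_n` (inside the obstacle the ratio is `0`) and `b ∈ Λ_n ∖ T`. [cite: FriedliVelenik2017, Exercise 3.12] -/
theorem farSrc_screening_mem_Icc {n : ℕ} {T : Finset (Site 3)} {a b : Site 3} (han : a ∈ box 3 n)
    (hb : b ∈ box 3 n \ T) : 0 ≤ screening n T a b ∧ screening n T a b ≤ 1 := by
  by_cases haT : a ∈ T
  · rw [farSrc_screening_eq_zero haT hb]; exact ⟨le_rfl, zero_le_one⟩
  · have ha : a ∈ box 3 n \ T := Finset.mem_sdiff.2 ⟨han, haT⟩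
    exact ⟨floorsRed_screening_nonneg ha hb, nearSrc_screening_le_one ha hb⟩

/-- A far probe end `dn M = (2M,-M,0)` lies outside `Λ_r` once `r < 2M`. [folklore] -/
theorem farSrc_dn_not_mem_box {r M : ℕ} (h : r < 2 * M) : dn M ∉ box 3 r := by
  intro hd
  obtain ⟨hd0, -, -⟩ := dn_coords M
  have h' : (r : ℤ) < 2 * (M : ℤ) := by exact_mod_cast h
  rw [mem_box_three, hd0] at hd
  omega

/-- The aspect inequality `2^{k+1} < 2·2^{K+3}` for `k ≤ K + 2`. [folklore] -/
theorem farSrc_two_pow_lt {k K : ℕ} (h : k ≤ K + 2) : 2 ^ (k + 1) < 2 * 2 ^ (K + 3) :=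
  calc 2 ^ (k + 1) < 2 ^ (K + 3 + 1) := Nat.pow_lt_pow_right (by norm_num) (by omega)
    _ = 2 * 2 ^ (K + 3) := by rw [pow_succ, mul_comm]

/-! ### Symmetry of the screening ratio; the double-ratio form of the far-end comparison -/

/-- The depleted box two-point function is symmetric in its two points (`σ_aσ_b = σ_bσ_a`). [folklore] -/
theorem farSrc_boxTwoPoint_comm (n : ℕ) (T : Finset (Site 3)) (a b : Site 3) :
    boxTwoPoint n T a b = boxTwoPoint n T b a := by
  -- adapted from `isingTwoPoint_symm` (AizenmanGrahamInequality.lean), region kept abstract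
  have key : ∀ R : Finset (Site 3), isingTwoPoint (zdGraph 3) R (criticalBeta 3) 0 .free a b =
      isingTwoPoint (zdGraph 3) R (criticalBeta 3) 0 .free b a := fun R => by
    unfold isingTwoPoint spinPair
    congr 1; funext σ; ring
  exact key _

/-- The screening ratio is symmetric in the probe pair: `S⁽ⁿ⁾_{ab}(T) = S⁽ⁿ⁾_{ba}(T)`. [folklore] -/
theorem farSrc_screening_comm (n : ℕ) (T : Finset (Site 3)) (a b : Site 3) :
    screening n T a b = screening n T b a := by
  unfold screening
  rw [farSrc_boxTwoPoint_comm n T a b, farSrc_boxTwoPoint_comm n ∅ a b]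

/-- **Double ratio ⇒ additive far-end comparison** at one obstacle: if
`⟨σ_aσ_{z'}⟩_{Λ_n∖T}·⟨σ_aσ_z⟩_{Λ_n} ≤ (1+ε)·⟨σ_aσ_z⟩_{Λ_n∖T}·⟨σ_aσ_{z'}⟩_{Λ_n}` (`a, z, z' ∈ Λ_n ∖ T`), then
`S⁽ⁿ⁾_{a z'}(T) ≤ (1+ε)·S⁽ⁿ⁾_{a z}(T) ≤ S⁽ⁿ⁾_{a z}(T) + ε` (the source version `nearSrc_screening_le_of_doubleRatio`, transposed). [folklore] -/
theorem farSrc_screening_le_of_doubleRatio {n : ℕ} {T : Finset (Site 3)} {a z z' : Site 3} {ε : ℝ} (hε : 0 ≤ ε)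
    (ha : a ∈ box 3 n \ T) (hz : z ∈ box 3 n \ T) (hz' : z' ∈ box 3 n \ T)
    (h : boxTwoPoint n T a z' * boxTwoPoint n ∅ a z ≤ (1 + ε) * (boxTwoPoint n T a z * boxTwoPoint n ∅ a z')) :
    screening n T a z' ≤ screening n T a z + ε := by
  rw [farSrc_screening_comm n T a z', farSrc_screening_comm n T a z]
  refine nearSrc_screening_le_of_doubleRatio hε hz hz' ha ?_
  rwa [farSrc_boxTwoPoint_comm n T z' a, farSrc_boxTwoPoint_comm n ∅ z a, farSrc_boxTwoPoint_comm n T z a,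
    farSrc_boxTwoPoint_comm n ∅ z' a]

/-! ### Pointwise: the two comparisons at the random obstacle -/

/-- **Pointwise upper comparison**: if `S_{a,b'}(T) ≤ S_{a,b}(T) + ε` for every obstacle `T` in the annulus off `a`,
then `annWeight(a,b') ≤ clip_{[0,1]} S_{a,b}(C_{2^{k+1}}(0) ∖ Λ_{2^k}) + ε` at every configuration (`b, b'` beyond
`Λ_{2^{k+1}}`, so off the obstacle; on `{b' ∈ C}` the left side is `0`; on the junk branch `a ∈ T_ω` it is `0`). [folklore] -/
theorem farSrc_annWeight_le {n k : ℕ} {a b b' : Site 3} {ε : ℝ} (hε : 0 ≤ ε) (han : a ∈ box 3 n)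
    (hbn : b ∈ box 3 n) (hb'n : b' ∈ box 3 n) (hbk : b ∉ box 3 (2 ^ (k + 1))) (hb'k : b' ∉ box 3 (2 ^ (k + 1)))
    (h2 : ∀ T : Finset (Site 3), T ⊆ box 3 (2 ^ (k + 1)) \ box 3 (2 ^ k) → a ∉ T →
      screening n T a b' ≤ screening n T a b + ε)
    (ω : BondConfig (Site 3)) :
    annWeight n k 0 a b' ω ≤
      max 0 (min 1 (screening n (innerCluster (2 ^ (k + 1)) 0 ω \ box 3 (2 ^ k)) a b)) + ε := by
  classical
  have hT : annPiece k 0 ω ⊆ box 3 (2 ^ (k + 1)) \ box 3 (2 ^ k) := nearSrc_annPiece_subset k 0 ω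
  have hbT : b ∈ box 3 n \ annPiece k 0 ω :=
    Finset.mem_sdiff.2 ⟨hbn, fun h => hbk (Finset.mem_sdiff.1 (hT h)).1⟩
  have hb'T : b' ∈ box 3 n \ annPiece k 0 ω :=
    Finset.mem_sdiff.2 ⟨hb'n, fun h => hb'k (Finset.mem_sdiff.1 (hT h)).1⟩
  have h0 : 0 ≤ max 0 (min 1 (screening n (innerCluster (2 ^ (k + 1)) 0 ω \ box 3 (2 ^ k)) a b)) :=
    le_max_left _ _
  unfold annWeight
  split_ifs with hb'C
  · linarith
  · change screening n (annPiece k 0 ω) a b' ≤ max 0 (min 1 (screening n (annPiece k 0 ω) a b)) + ε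
    by_cases haT : a ∈ annPiece k 0 ω
    · rw [farSrc_screening_eq_zero haT hb'T]
      change 0 ≤ max 0 (min 1 (screening n (innerCluster (2 ^ (k + 1)) 0 ω \ box 3 (2 ^ k)) a b)) + ε
      linarith
    · obtain ⟨hS0, hS1⟩ := farSrc_screening_mem_Icc (T := annPiece k 0 ω) han hbT
      rw [min_eq_right hS1, max_eq_right hS0]
      exact h2 _ hT haT

/-- **Pointwise lower comparison**: `clip_{[0,1]} S_{a,b}(C_{2^{k+1}}(0) ∖ Λ_{2^k}) ≤ annWeight(a,b) + 𝟙[b ∈ C(0)]`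
(`b` beyond `Λ_{2^{k+1}}`; off `{b ∈ C}` both sides are `S ∈ [0,1]`, on it the right side is `1`). [folklore] -/
theorem farSrc_clip_le_annWeight_add {n k : ℕ} {a b : Site 3} (han : a ∈ box 3 n) (hbn : b ∈ box 3 n)
    (hbk : b ∉ box 3 (2 ^ (k + 1))) (ω : BondConfig (Site 3)) :
    max 0 (min 1 (screening n (innerCluster (2 ^ (k + 1)) 0 ω \ box 3 (2 ^ k)) a b)) ≤
      annWeight n k 0 a b ω + (openConn 0 b).indicator 1 ω := by
  classical
  have hT : annPiece k 0 ω ⊆ box 3 (2 ^ (k + 1)) \ box 3 (2 ^ k) := nearSrc_annPiece_subset k 0 ω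
  have hbT : b ∈ box 3 n \ annPiece k 0 ω :=
    Finset.mem_sdiff.2 ⟨hbn, fun h => hbk (Finset.mem_sdiff.1 (hT h)).1⟩
  obtain ⟨hS0, hS1⟩ := farSrc_screening_mem_Icc (T := annPiece k 0 ω) han hbT
  change max 0 (min 1 (screening n (annPiece k 0 ω) a b)) ≤ _
  rw [min_eq_right hS1, max_eq_right hS0]
  unfold annWeight
  by_cases hbC : b ∈ openCluster ω 0
  · rw [if_pos hbC, Set.indicator_of_mem (show ω ∈ openConn 0 b from hbC), Pi.one_apply, zero_add]
    exact hS1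
  · rw [if_neg hbC, Set.indicator_of_notMem (show ω ∉ openConn 0 b from hbC), add_zero]

/-! ### The one-point density of the far probe end, read on the box law -/

/-- `P^{{0}∆{up m},∅}_{Λ_n}[dn m ∈ C(0)]` read on the trace law equals the same probability on pairs of box currents
(the trace law is the push-forward under `sourcedTrace`). [cite: AizenmanDuminilCopinAnnals2021, eq. (3.10)] -/
theorem farSrc_real_openConn_eq (n m : ℕ) :
    (sourcedDoubleCurrentLaw 3 n (criticalBeta 3) ({0} ∆ {up m}) ∅).real (openConn 0 (dn m)) =
      (doubleCurrentMeasure (freeBoxGraph 3 n) (criticalBeta 3) (boxSources 3 n ({0} ∆ {up m})) ∅).real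
        {p | dn m ∈ openCluster (sourcedTrace 3 n p) 0} := by
  rw [measureReal_def, sourcedDoubleCurrentLaw_apply n _ _ _ (measurableSet_openConn_holds _ _),
    boxSources_empty, measureReal_def]
  rfl

/-! ### The transfer at one box size -/

/-- **The transfer step** (`ε ≥ 0`, all points in `Λ_n`, both far probe ends beyond `Λ_{2^{k+1}}`): IF (M) every
`[0,1]`-valued functional of the explored cluster `C_{2^{k+1}}(0)` has `P^{0,up M'}`-mean at most its `P^{0,up M}`-mean
`+ ε`, (O) `S_{a,dn M'}(T) ≤ S_{a,dn M}(T) + ε` for every obstacle `T` in the annulus off `a`, and (D)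
`P^{0,up M;∅}_{Λ_n}[dn M ∈ C(0)] ≤ ε`, THEN `annScreen n k 0 (up M') a (dn M') ≤ annScreen n k 0 (up M) a (dn M) + 3ε`
(integrate the two pointwise comparisons against the two probability measures). [folklore] -/
theorem farSrc_step {n k M M' : ℕ} {a : Site 3} {ε : ℝ} (hε : 0 ≤ ε)
    (hup : up M ∈ box 3 n) (hup' : up M' ∈ box 3 n) (hdn : dn M ∈ box 3 n) (hdn' : dn M' ∈ box 3 n)
    (han : a ∈ box 3 n) (hM : 2 ^ (k + 1) < 2 * M) (hM' : 2 ^ (k + 1) < 2 * M')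
    (h1 : ∀ f : Finset (Site 3) → ℝ, (∀ C, 0 ≤ f C) → (∀ C, f C ≤ 1) →
      ∫ ω, f (innerCluster (2 ^ (k + 1)) 0 ω) ∂(sourcedDoubleCurrentLaw 3 n (criticalBeta 3) ({0} ∆ {up M'}) ∅) ≤
        ∫ ω, f (innerCluster (2 ^ (k + 1)) 0 ω) ∂(sourcedDoubleCurrentLaw 3 n (criticalBeta 3) ({0} ∆ {up M}) ∅) + ε)
    (h2 : ∀ T : Finset (Site 3), T ⊆ box 3 (2 ^ (k + 1)) \ box 3 (2 ^ k) → a ∉ T →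
      screening n T a (dn M') ≤ screening n T a (dn M) + ε)
    (h3 : (sourcedDoubleCurrentLaw 3 n (criticalBeta 3) ({0} ∆ {up M}) ∅).real (openConn 0 (dn M)) ≤ ε) :
    annScreen n k 0 (up M') a (dn M') ≤ annScreen n k 0 (up M) a (dn M) + 3 * ε := by
  haveI := floorsRed_isProbabilityMeasure (n := n) hup
  haveI := floorsRed_isProbabilityMeasure (n := n) hup'
  have hbk : dn M ∉ box 3 (2 ^ (k + 1)) := farSrc_dn_not_mem_box hM
  have hbk' : dn M' ∉ box 3 (2 ^ (k + 1)) := farSrc_dn_not_mem_box hM'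
  -- the clipped functional of the explored cluster
  set f : Finset (Site 3) → ℝ := fun C => max 0 (min 1 (screening n (C \ box 3 (2 ^ k)) a (dn M))) with hf
  have hf0 : ∀ C, 0 ≤ f C := fun C => le_max_left _ _
  have hf1 : ∀ C, f C ≤ 1 := fun C => max_le zero_le_one (min_le_left _ _)
  have hfabs : ∀ ω : BondConfig (Site 3), |f (innerCluster (2 ^ (k + 1)) 0 ω)| ≤ 1 := fun ω => by
    rw [abs_of_nonneg (hf0 _)]; exact hf1 _
  have hind : ∀ ω : BondConfig (Site 3), |(openConn 0 (dn M)).indicator (1 : BondConfig (Site 3) → ℝ) ω| ≤ 1 :=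
    fun ω => by
      classical
      rw [Set.indicator_apply]; split_ifs <;> simp
  -- integrability of the four integrands
  have hiW' : Integrable (fun ω => annWeight n k 0 a (dn M') ω)
      (sourcedDoubleCurrentLaw 3 n (criticalBeta 3) ({0} ∆ {up M'}) ∅) :=
    floorsRed_integrable _ (nearSrc_abs_annWeight_le n k 0 a (dn M'))
  have hif' : Integrable (fun ω => f (innerCluster (2 ^ (k + 1)) 0 ω))
      (sourcedDoubleCurrentLaw 3 n (criticalBeta 3) ({0} ∆ {up M'}) ∅) := floorsRed_integrable _ hfabs
  have hif : Integrable (fun ω => f (innerCluster (2 ^ (k + 1)) 0 ω))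
      (sourcedDoubleCurrentLaw 3 n (criticalBeta 3) ({0} ∆ {up M}) ∅) := floorsRed_integrable _ hfabs
  have hiW : Integrable (fun ω => annWeight n k 0 a (dn M) ω)
      (sourcedDoubleCurrentLaw 3 n (criticalBeta 3) ({0} ∆ {up M}) ∅) :=
    floorsRed_integrable _ (nearSrc_abs_annWeight_le n k 0 a (dn M))
  have hiI : Integrable (fun ω => (openConn 0 (dn M)).indicator (1 : BondConfig (Site 3) → ℝ) ω)
      (sourcedDoubleCurrentLaw 3 n (criticalBeta 3) ({0} ∆ {up M}) ∅) := floorsRed_integrable _ hind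
  -- (O) at the random obstacle, integrated against `P^{0,up M'}`
  have hA : ∫ ω, annWeight n k 0 a (dn M') ω ∂(sourcedDoubleCurrentLaw 3 n (criticalBeta 3) ({0} ∆ {up M'}) ∅) ≤
      ∫ ω, (f (innerCluster (2 ^ (k + 1)) 0 ω) + ε) ∂(sourcedDoubleCurrentLaw 3 n (criticalBeta 3) ({0} ∆ {up M'}) ∅) :=
    integral_mono hiW' (hif'.add (integrable_const ε)) fun ω => farSrc_annWeight_le hε han hdn hdn' hbk hbk' h2 ω
  have hB : ∫ ω, (f (innerCluster (2 ^ (k + 1)) 0 ω) + ε) ∂(sourcedDoubleCurrentLaw 3 n (criticalBeta 3) ({0} ∆ {up M'}) ∅) =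
      ∫ ω, f (innerCluster (2 ^ (k + 1)) 0 ω) ∂(sourcedDoubleCurrentLaw 3 n (criticalBeta 3) ({0} ∆ {up M'}) ∅) + ε := by
    rw [integral_add hif' (integrable_const ε), integral_const]
    simp
  -- (M) for the clipped functional
  have hmix := h1 f hf0 hf1
  -- the indicator put back, integrated against `P^{0,up M}`
  have hC : ∫ ω, f (innerCluster (2 ^ (k + 1)) 0 ω) ∂(sourcedDoubleCurrentLaw 3 n (criticalBeta 3) ({0} ∆ {up M}) ∅) ≤
      ∫ ω, (annWeight n k 0 a (dn M) ω + (openConn 0 (dn M)).indicator (1 : BondConfig (Site 3) → ℝ) ω)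
        ∂(sourcedDoubleCurrentLaw 3 n (criticalBeta 3) ({0} ∆ {up M}) ∅) :=
    integral_mono hif (hiW.add hiI) fun ω => farSrc_clip_le_annWeight_add han hdn hbk ω
  have hD : ∫ ω, (annWeight n k 0 a (dn M) ω + (openConn 0 (dn M)).indicator (1 : BondConfig (Site 3) → ℝ) ω)
        ∂(sourcedDoubleCurrentLaw 3 n (criticalBeta 3) ({0} ∆ {up M}) ∅) =
      ∫ ω, annWeight n k 0 a (dn M) ω ∂(sourcedDoubleCurrentLaw 3 n (criticalBeta 3) ({0} ∆ {up M}) ∅) +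
        (sourcedDoubleCurrentLaw 3 n (criticalBeta 3) ({0} ∆ {up M}) ∅).real (openConn 0 (dn M)) := by
    rw [integral_add hiW hiI, integral_indicator_one (measurableSet_openConn_holds _ _)]
  unfold annScreen
  linarith

/-! ### The registered reduction -/

/-- **FAR-SOURCE INSENSITIVITY FROM STRAND MIXING AND FAR-END OSCILLATION** — registered helper of the open stub
`stub_farSource`. IF
(M) STRAND MIXING: for every `ε > 0` there is an aspect `A` such that for all large octaves `k`, all far scales
`K, K' ≥ k + A` and all large `n`, every `[0,1]`-valued functional of the cluster of `0` explored inside `Λ_{2^{k+1}}` has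
`P^{0,up 2^{K'+3};∅}_{Λ_n}`-mean at most its `P^{0,up 2^{K+3};∅}_{Λ_n}`-mean `+ ε` (total-variation insensitivity of the law
of the explored cluster to the far source, uniformly in the scale: the uniform form of Panis 2025 Thm 3.1 / Thm 2.4), and
(O) FAR-END OSCILLATION: for every `ε > 0` and every `c` there is `A` such that for all large `k`, all `K, K' ≥ k + A`, all
large `n`, every obstacle `T ⊆ Λ_{2^{k+1}} ∖ Λ_{2^k}` and every near point `a ∈ Λ_{2^{k+c}} ∖ T`,
`S⁽ⁿ⁾_{a,dn 2^{K'+3}}(T) ≤ S⁽ⁿ⁾_{a,dn 2^{K+3}}(T) + ε` (the `ℤ³`, uniform-in-scale far-end analogue of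
Aizenman–Duminil-Copin 2021 Thm 6.4 / (6.16)),
THEN `FarSourceInsensitivity` holds, with `A(μ,j,F) = A_M(μ/6) + A_O(μ/6, c(F)) + c(F)`, `F ⊆ Λ_c`. Proof: `farSrc_step` with
`ε = μ/6` at `M = 2^{K+3}`, `M' = 2^{k+A+3}`, the density of `dn M` being `< μ/6` for large `k` (`dnDensity_eventually_lt`).
Neither (M) nor (O) is proved here. [cite: Panis2025, Thm 3.1] -/
theorem farSource_of_strandMixing_probeOscillation : (∀ ε : ℝ, 0 < ε → ∃ A : ℕ, ∀ᶠ k : ℕ in atTop, ∀ K K' : ℕ, k + A ≤ K → k + A ≤ K' → ∀ᶠ n : ℕ in atTop, ∀ f : Finset (Site 3) → ℝ, (∀ C, 0 ≤ f C) → (∀ C, f C ≤ 1) → ∫ ω, f (innerCluster (2 ^ (k + 1)) 0 ω) ∂(sourcedDoubleCurrentLaw 3 n (criticalBeta 3) ({0} ∆ {up (2 ^ (K' + 3))}) ∅) ≤ ∫ ω, f (innerCluster (2 ^ (k + 1)) 0 ω) ∂(sourcedDoubleCurrentLaw 3 n (criticalBeta 3) ({0} ∆ {up (2 ^ (K + 3))})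 ∅) + ε) → (∀ ε : ℝ, 0 < ε → ∀ c : ℕ, ∃ A : ℕ, ∀ᶠ k : ℕ in atTop, ∀ K K' : ℕ, k + A ≤ K → k + A ≤ K' → ∀ᶠ n : ℕ in atTop, ∀ T : Finset (Site 3), T ⊆ box 3 (2 ^ (k + 1)) \ box 3 (2 ^ k) → ∀ a ∈ box 3 (2 ^ (k + c)) \ T, screening n T a (dn (2 ^ (K' + 3))) ≤ screening n T a (dn (2 ^ (K + 3))) + ε) → FarSourceInsensitivity := by
  intro hmix hosc μ hμ j F
  have hε : 0 < μ / 6 := by positivity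
  obtain ⟨A₁, h1⟩ := hmix (μ / 6) hε
  obtain ⟨c, hc⟩ := exists_forall_subset_box 3 F
  obtain ⟨A₂, h2⟩ := hosc (μ / 6) hε c
  obtain ⟨m₁, -, h3⟩ := dnDensity_eventually_lt hε
  refine ⟨A₁ + A₂ + c, ?_⟩
  filter_upwards [h1, h2, eventually_ge_atTop m₁] with k hk1 hk2 hkm K hK
  have hm₁ : m₁ ≤ 2 ^ (K + 3) :=
    calc m₁ ≤ K := by omega
      _ ≤ 2 ^ K := Nat.lt_two_pow_self.le
      _ ≤ 2 ^ (K + 3) := Nat.pow_le_pow_right (by norm_num) (by omega)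
  have hfar : 2 ^ (k + 1) < 2 * 2 ^ (K + 3) := farSrc_two_pow_lt (by omega)
  have hfar' : 2 ^ (k + 1) < 2 * 2 ^ (k + (A₁ + A₂ + c) + 3) := farSrc_two_pow_lt (by omega)
  have hdeep : ∀ u ∈ F, deepSource k j u ∈ box 3 (2 ^ (k + c)) := fun u hu => by
    have h := zsmul_mem_box (L := 2 ^ (k - j)) (hc c le_rfl hu)
    refine box_mono 3 ?_ h
    calc c * 2 ^ (k - j) ≤ 2 ^ c * 2 ^ k :=
          Nat.mul_le_mul Nat.lt_two_pow_self.le (Nat.pow_le_pow_right (by norm_num) (Nat.sub_le k j))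
      _ = 2 ^ (k + c) := by rw [← pow_add, add_comm]
  filter_upwards [hk1 K (k + (A₁ + A₂ + c)) (by omega) (by omega), hk2 K (k + (A₁ + A₂ + c)) (by omega) (by omega),
    h3 (2 ^ (K + 3)) hm₁, eventually_mem_boxes (2 ^ (K + 3)) k j F,
    eventually_mem_boxes (2 ^ (k + (A₁ + A₂ + c) + 3)) k j F] with n hn1 hn2 hn3 hboxK hboxK' u hu hhyp
  obtain ⟨hupK, hdnK, -, hdeepn⟩ := hboxK
  obtain ⟨hupK', hdnK', -, -⟩ := hboxK'
  have hdens : (sourcedDoubleCurrentLaw 3 n (criticalBeta 3) ({0} ∆ {up (2 ^ (K + 3))}) ∅).real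
      (openConn 0 (dn (2 ^ (K + 3)))) ≤ μ / 6 := by
    rw [farSrc_real_openConn_eq]; exact hn3.le
  have step := farSrc_step hε.le hupK hupK' hdnK hdnK' (hdeepn u hu) hfar hfar' hn1
    (fun T hT haT => hn2 T hT _ (Finset.mem_sdiff.2 ⟨hdeep u hu, haT⟩)) hdens
  linarith

/-- **FAR-SOURCE INSENSITIVITY FROM STRAND MIXING AND THE FAR-END DOUBLE-RATIO BOUND** (the multiplicative form of (O),
in the vocabulary of the depleted box two-point function alone). IF (M) as in
`farSource_of_strandMixing_probeOscillation`, and (O×) for every `ε > 0` and every `c` there is `A` such that for all large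
`k`, all `K, K' ≥ k + A`, all large `n`, every obstacle `T ⊆ Λ_{2^{k+1}} ∖ Λ_{2^k}` and every `a ∈ Λ_{2^{k+c}} ∖ T`, with
`z = dn 2^{K+3}`, `z' = dn 2^{K'+3}`:  `⟨σ_aσ_{z'}⟩_{Λ_n∖T}·⟨σ_aσ_z⟩_{Λ_n} ≤ (1+ε)·⟨σ_aσ_z⟩_{Λ_n∖T}·⟨σ_aσ_{z'}⟩_{Λ_n}` (the relative
weight of the far end `z'` against `z` is at most `1+ε` times larger off `T` than in the full box — regularity of
`z ↦ ⟨σ_aσ_z⟩_D` over far points at aspect `≥ 2^A` from `Λ_{2^{k+c}} ⊇ {a} ∪ T ∪ (Λ_n ∖ D)`, uniformly in the scale; for the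
Gaussian free field: the elliptic Harnack inequality at infinity), THEN `FarSourceInsensitivity` holds
(`farSrc_screening_le_of_doubleRatio`: `S_{a z'}(T) ≤ (1+ε)S_{a z}(T) ≤ S_{a z}(T) + ε`). (O×) is the `ℤ³` far-end analogue of
Aizenman–Duminil-Copin 2021 Thm 6.4 / (6.16); it is NOT proved here. [cite: AizenmanDuminilCopinAnnals2021, §6.2, Thm 6.4] -/
theorem farSource_of_strandMixing_probeDoubleRatio : (∀ ε : ℝ, 0 < ε → ∃ A : ℕ, ∀ᶠ k : ℕ in atTop, ∀ K K' : ℕ, k + A ≤ K → k + A ≤ K' → ∀ᶠ n : ℕ in atTop, ∀ f : Finset (Site 3) → ℝ, (∀ C, 0 ≤ f C) → (∀ C, f C ≤ 1) → ∫ ω, f (innerCluster (2 ^ (k + 1)) 0 ω) ∂(sourcedDoubleCurrentLaw 3 n (criticalBeta 3) ({0} ∆ {up (2 ^ (K' + 3))}) ∅) ≤ ∫ ω, f (innerCluster (2 ^ (k + 1)) 0 ω) ∂(sourcedDoubleCurrentLaw 3 n (criticalBeta 3) ({0} ∆ {up (2 ^ (K + 3))}) ∅) + ε) → (∀ ε :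 ℝ, 0 < ε → ∀ c : ℕ, ∃ A : ℕ, ∀ᶠ k : ℕ in atTop, ∀ K K' : ℕ, k + A ≤ K → k + A ≤ K' → ∀ᶠ n : ℕ in atTop, ∀ T : Finset (Site 3), T ⊆ box 3 (2 ^ (k + 1)) \ box 3 (2 ^ k) → ∀ a ∈ box 3 (2 ^ (k + c)) \ T, boxTwoPoint n T a (dn (2 ^ (K' + 3))) * boxTwoPoint n ∅ a (dn (2 ^ (K + 3))) ≤ (1 + ε) * (boxTwoPoint n T a (dn (2 ^ (K + 3))) * boxTwoPoint n ∅ a (dn (2 ^ (K' + 3))))) → FarSourceInsensitivity := by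
  intro hmix hdr
  refine farSource_of_strandMixing_probeOscillation hmix fun ε hε c => ?_
  obtain ⟨A, hA⟩ := hdr ε hε c
  refine ⟨A, ?_⟩
  filter_upwards [hA] with k hk K K' hK hK'
  have hzk : dn (2 ^ (K + 3)) ∉ box 3 (2 ^ (k + 1)) := farSrc_dn_not_mem_box (farSrc_two_pow_lt (by omega))
  have hzk' : dn (2 ^ (K' + 3)) ∉ box 3 (2 ^ (k + 1)) := farSrc_dn_not_mem_box (farSrc_two_pow_lt (by omega))
  filter_upwards [hk K K' hK hK', eventually_ge_atTop (2 * 2 ^ (K + 3) + 1), eventually_ge_atTop (2 * 2 ^ (K' + 3) + 1),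
    eventually_ge_atTop (2 ^ (k + c))] with n hn hnK hnK' hnc T hT a ha
  obtain ⟨-, -, hz⟩ := floorsRed_mem_box hnK
  obtain ⟨-, -, hz'⟩ := floorsRed_mem_box hnK'
  obtain ⟨hac, haT⟩ := Finset.mem_sdiff.1 ha
  exact farSrc_screening_le_of_doubleRatio hε.le (Finset.mem_sdiff.2 ⟨box_mono 3 hnc hac, haT⟩)
    (Finset.mem_sdiff.2 ⟨hz, fun h => hzk (Finset.mem_sdiff.1 (hT h)).1⟩)
    (Finset.mem_sdiff.2 ⟨hz', fun h => hzk' (Finset.mem_sdiff.1 (hT h)).1⟩) (hn T hT a ha)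

end Summit.CriticalPhenomena.Ising3DConformalLimit.EnergyNotSigmaSquaredGapForcesFarMerging

end
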